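import Mathlib

/-!
# Route `FilamentSkeletonRss` · child crux `TangentSkeletonNearStraightL` (stmt-NavierStokesRegularity-23320) · registered line
# `child_tangent_analytic_strip_L` (b0b56c52900dd90a), stub `stub_stripPropagation` — brick: TIGHT LOGARITHM BOUNDS FOR THE CORNER NUMERICS

The deviation profiles of the stadium (`Theorems.StadiumDeviationRatio`, `Theorems.StadiumLegProfiles`) are `log(n/(n−1))`,
`log(n/(n−1)) − 1/n` at disc ratio `n`; the landed numeric tool is `log_ratio_le : log(n/(n−1)) ≤ 1/(n−1)`, sharp enough at the ratios `14`
(`cs√Γ/16`) and `7–8` but NOT at the ratios `3–4` of the registered quarter-width corner: there `1/(n−1)` overestimates the second-order profile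
`log(n/(n−1)) − 1/n` by a factor `2.2` (`n = 4`) to `2.3` (`n = 3`), which alone destroys the corner margins of the hand's blueprint
(evidence `CORNER-QUARTER-BLUEPRINT-leafhand-15-g0.md` on 23320).  This file records the tight bounds the assembly needs:
* `neg_log_one_sub_bounds` — two-sided rational enclosure of `−log(1 − x) = log(1/(1−x))`, `0 ≤ x < 1`, by the partial sums
  `Σ_{i<N} x^{i+1}/(i+1) ± x^{N+1}/(1−x)` (from Mathlib's `Real.abs_log_sub_add_sum_range_le`); `log_div_sub_bounds` — the same for
  `log(R/(R−t))`, `0 ≤ t < R` (ratio form, `x = t/R`);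
* `log_three_halves_bounds`, `log_four_thirds_bounds` — `log(3/2) ∈ [0.4054651, 0.4054652]`, `log(4/3) ∈ [0.2876820, 0.2876821]`
  from Mathlib's `Real.log_two_near_10`, `Real.log_three_near_10` (the corner ratios `3` and `4`).
HONEST FRAMING: elementary numerics for a plan about a HYPOTHETICAL filament skeleton on the NEGATIVE side of a MODEL route; the stub
`stub_stripPropagation` is NOT closed by this file; nothing here bears on Navier–Stokes regularity or blow-up.  `--supports stmt-NavierStokesRegularity-23320`.
-/

set_option linter.dupNamespace false

noncomputable section

namespace Summit.NavierStokesRegularity.NavierStokesRegularity.Theorems.StadiumLogBounds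

open Finset

/-- **Series enclosure of `−log(1−x)`.**  For `0 ≤ x < 1` and every `N`:
`Σ_{i<N} x^{i+1}/(i+1) − x^{N+1}/(1−x) ≤ −log(1−x) ≤ Σ_{i<N} x^{i+1}/(i+1) + x^{N+1}/(1−x)`. [folklore] -/
theorem neg_log_one_sub_bounds {x : ℝ} (hx0 : 0 ≤ x) (hx1 : x < 1) (N : ℕ) :
    (∑ i ∈ range N, x ^ (i + 1) / (i + 1)) - x ^ (N + 1) / (1 - x) ≤ -Real.log (1 - x) ∧
    -Real.log (1 - x) ≤ (∑ i ∈ range N, x ^ (i + 1) / (i + 1)) + x ^ (N + 1) / (1 - x) := by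
  have habs : |x| < 1 := by rw [abs_of_nonneg hx0]; exact hx1
  have h := Real.abs_log_sub_add_sum_range_le habs N
  rw [abs_of_nonneg hx0] at h
  obtain ⟨h1, h2⟩ := abs_le.1 h
  constructor <;> linarith

/-- **Ratio form.**  For `0 ≤ t < R`, with `x = t/R`:
`Σ_{i<N} x^{i+1}/(i+1) − x^{N+1}/(1−x) ≤ log(R/(R−t)) ≤ Σ_{i<N} x^{i+1}/(i+1) + x^{N+1}/(1−x)`. [folklore] -/
theorem log_div_sub_bounds {R t : ℝ} (ht : 0 ≤ t) (htR : t < R) (N : ℕ) :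
    (∑ i ∈ range N, (t / R) ^ (i + 1) / (i + 1)) - (t / R) ^ (N + 1) / (1 - t / R) ≤ Real.log (R / (R - t)) ∧
    Real.log (R / (R - t)) ≤ (∑ i ∈ range N, (t / R) ^ (i + 1) / (i + 1)) + (t / R) ^ (N + 1) / (1 - t / R) := by
  have hR : 0 < R := lt_of_le_of_lt ht htR
  have hx0 : 0 ≤ t / R := div_nonneg ht hR.le
  have hx1 : t / R < 1 := (div_lt_one hR).2 htR
  have hlog : Real.log (R / (R - t)) = -Real.log (1 - t / R) := by
    have hRt : 0 < R - t := by linarith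
    have e : 1 - t / R = (R - t) / R := by field_simp
    rw [e, Real.log_div hRt.ne' hR.ne', Real.log_div hR.ne' hRt.ne']
    ring
  rw [hlog]
  exact neg_log_one_sub_bounds hx0 hx1 N

/-- **`log(3/2)` to seven places** (disc ratio `3`, the registered output corner): `0.4054651 ≤ log(3/2) ≤ 0.4054652`. [folklore] -/
theorem log_three_halves_bounds : (0.4054651 : ℝ) ≤ Real.log (3 / 2) ∧ Real.log (3 / 2) ≤ 0.4054652 := by
  have h3 := abs_le.1 Real.log_three_near_10
  have h2 := abs_le.1 Real.log_two_near_10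
  rw [Real.log_div (by norm_num) (by norm_num)]
  constructor <;> norm_num at h3 h2 ⊢ <;> linarith

/-- **`log(4/3)` to seven places** (disc ratio `4`, a quarter width inside the corner): `0.2876820 ≤ log(4/3) ≤ 0.2876821`. [folklore] -/
theorem log_four_thirds_bounds : (0.2876820 : ℝ) ≤ Real.log (4 / 3) ∧ Real.log (4 / 3) ≤ 0.2876821 := by
  have h3 := abs_le.1 Real.log_three_near_10
  have h2 := abs_le.1 Real.log_two_near_10
  have h4 : Real.log 4 = 2 * Real.log 2 := by
    rw [show (4:ℝ) = 2 ^ 2 by norm_num, Real.log_pow]; norm_num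
  rw [Real.log_div (by norm_num) (by norm_num), h4]
  constructor <;> norm_num at h3 h2 ⊢ <;> linarith

/-- **The corner profiles at ratio 3 and 4, enclosed** (`M = 2`): the second-order real-part profile
`E(n) = 4√3·(log(n/(n−1)) − 1/n)` satisfies `E(3) ≤ 4√3·0.0721319` and `E(4) ≤ 4√3·0.0376821`, against the landed crude bound
`4√3·(1/(n−1) − 1/n)` = `4√3·0.1667` resp. `4√3·0.0833`. [folklore] -/
theorem corner_profile_ratio_three_four :
    Real.log (3 / 2) - 1 / 3 ≤ 0.0721319 ∧ Real.log (4 / 3) - 1 / 4 ≤ 0.0376821 := by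
  have h1 := log_three_halves_bounds.2
  have h2 := log_four_thirds_bounds.2
  constructor <;> norm_num at h1 h2 ⊢ <;> linarith

end Summit.NavierStokesRegularity.NavierStokesRegularity.Theorems.StadiumLogBounds

end
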